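import Summits.NavierStokesRegularity.NavierStokesRegularity.Theorems.LerayQuarterDissipationRecurrentReductionDStage1
import Summits.NavierStokesRegularity.NavierStokesRegularity.Theorems.LerayQuarterDissipationRecurrentReductionDStage2
import Summits.NavierStokesRegularity.NavierStokesRegularity.Theorems.LerayQuarterDissipationRecurrentReductionDSlices
import Literature.Analysis.FluidPDE.KNSSMildDecayHorizontal
import HarnessLib

/-!
# Route `LerayQuarterDissipation`, item `RecurrentReductionD` (stmt-NavierStokesRegularity-22507):
# sup-norm ε-regularity for the class `𝒟` — assembly

Helper file (theorems only, `--supports` the item).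

* `eLpNorm_six_le_of_dissipationLaw` — in the class `𝒟` (Type-I ancient mild + Leray's law
  `∫|∇u(s)|² ≤ K/√(−s)`) every slice is in `L⁶` with `‖u(s)‖₆ ≤ C_S √K⁺ (−s)^{−1/4}`
  (Sobolev on slices, `exists_eLpNorm_six_slice_le`).
* `epsilon_regularity` — **sup-norm ε-regularity without pressure**: there are `t₁ < 0`, `A`,
  `ε₀ > 0` (depending only on the Type-I constant `C` and the `L⁶` constant `k₆`) such that every
  Type-I ancient mild field `v` (constant `C`) with `‖v(τ)‖₆ ≤ k₆(−τ)^{−1/4}` and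
  `‖v(t₁, y)‖ ≤ ε₀` for `‖y‖ ≤ A` obeys `‖v‖ ≤ 1` on `(t₁, 0) × B(0, 2)`. Proof: choose the
  parameters of Stage 1 (`stage1_typeI_small`) and Stage 2 (`stage2_bounded`) in the order
  `η, θ, M, t₁, A` as functions of `C, k₆` and the kernel constants, and chain the two stages.

References: G. Koch, N. Nadirashvili, G. Seregin, V. Šverák, arXiv:0709.3599, §4
[KochNadirashviliSereginSverak2009].
-/

noncomputable section

-- the summit and its single problem share the name (D-0017 nested layout)
set_option linter.dupNamespace false

namespace Summit.NavierStokesRegularity.NavierStokesRegularity.Theorems.RecurrentReductionD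

open MeasureTheory Set Function Filter Topology Metric
open Literature.Analysis Literature.Analysis.FluidPDE Literature.Analysis.UnboundedOperators
open scoped ENNReal NNReal

/-! ### `L⁶` slices in the class `𝒟` -/

/-- **Slices of `𝒟` are in `L⁶`**: `‖u(s)‖_{L⁶} ≤ C_S √(K⁺) (−s)^{−1/4}` for a Type-I ancient mild
field with Leray's dissipation law `∫|∇u(s)|² ≤ K/√(−s)` (`C_S` universal).
[cite: KochNadirashviliSereginSverak2009, proof of Thm. 6.1 (arXiv:0709.3599 p. 12)] -/
theorem eLpNorm_six_le_of_dissipationLaw :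
    ∃ CS : ℝ≥0, ∀ (C K : ℝ) (u : ℝ → EuclideanSpace ℝ (Fin 3) → EuclideanSpace ℝ (Fin 3)),
      IsTypeIAncientMild C u →
      (∀ s : ℝ, s < 0 → ∫⁻ x, ‖fderiv ℝ (u s) x‖ₑ ^ 2 ≤ ENNReal.ofReal (K / Real.sqrt (-s))) →
      ∀ s : ℝ, s < 0 → eLpNorm (u s) 6 volume ≤
        ENNReal.ofReal (((CS : ℝ) * Real.sqrt (max K 0)) * (-s) ^ (-(1 / 4 : ℝ))) := by
  obtain ⟨CS, hCS⟩ := exists_eLpNorm_six_slice_le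
  refine ⟨CS, fun C K u hu hlaw s hs => ?_⟩
  have hns : 0 < -s := neg_pos.2 hs
  have hfin : ∀ s : ℝ, s < 0 → ∫⁻ x, ‖fderiv ℝ (u s) x‖ₑ ^ 2 < ∞ :=
    fun s hs => (hlaw s hs).trans_lt ENNReal.ofReal_lt_top
  refine (hCS C u hu hfin s hs).trans ?_
  -- `‖∇u(s)‖₂ ≤ √(K⁺) (−s)^{−1/4}`
  have hK' : K / Real.sqrt (-s) ≤ max K 0 / Real.sqrt (-s) :=
    div_le_div_of_nonneg_right (le_max_left _ _) (Real.sqrt_nonneg _)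
  have hgrad : eLpNorm (fderiv ℝ (u s)) 2 volume ≤
      ENNReal.ofReal (Real.sqrt (max K 0) * (-s) ^ (-(1 / 4 : ℝ))) := by
    rw [eLpNorm_eq_lintegral_rpow_enorm_toReal two_ne_zero ENNReal.ofNat_ne_top]
    have e : (fun x => ‖fderiv ℝ (u s) x‖ₑ ^ ((2 : ℝ≥0∞).toReal)) =
        fun x => ‖fderiv ℝ (u s) x‖ₑ ^ 2 := by
      funext x
      rw [ENNReal.toReal_ofNat, show (2 : ℝ) = ((2 : ℕ) : ℝ) by norm_num, ENNReal.rpow_natCast]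
    rw [e, ENNReal.toReal_ofNat]
    have h1 : (∫⁻ x, ‖fderiv ℝ (u s) x‖ₑ ^ 2) ^ (1 / (2 : ℝ)) ≤
        ENNReal.ofReal (max K 0 / Real.sqrt (-s)) ^ (1 / (2 : ℝ)) :=
      ENNReal.rpow_le_rpow ((hlaw s hs).trans (ENNReal.ofReal_le_ofReal hK')) (by norm_num)
    refine h1.trans (le_of_eq ?_)
    rw [ENNReal.ofReal_rpow_of_nonneg (by positivity) (by norm_num)]
    congr 1
    rw [Real.div_rpow (le_max_right _ _) (Real.sqrt_nonneg _), Real.sqrt_eq_rpow, Real.sqrt_eq_rpow,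
      ← Real.rpow_mul hns.le, Real.rpow_neg hns.le, div_eq_mul_inv]
    norm_num
  calc (CS : ℝ≥0∞) * eLpNorm (fderiv ℝ (u s)) 2 volume
      ≤ (CS : ℝ≥0∞) * ENNReal.ofReal (Real.sqrt (max K 0) * (-s) ^ (-(1 / 4 : ℝ))) := by gcongr
    _ = _ := by
        rw [← ENNReal.ofReal_coe_nnreal, ← ENNReal.ofReal_mul NNReal.zero_le_coe]
        congr 1; ring

/-- The heat term in the ε-regularity bootstrap: with `A₁ = 4 + M√s < A` and
`‖v(−s, y)‖ ≤ 1/8` on `B(0, A)`, the numerical constraint `c_heat` gives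
`‖e^{(t+s)Δ}v(−s)(x)‖ ≤ 1/4` for `−s < t < 0`, `‖x‖ < 4 + M√(−t)`
(`norm_heatExtension_le_of_small_on_ball`). [folklore] -/
theorem heat_le_quarter {C : ℝ} {v : ℝ → EuclideanSpace ℝ (Fin 3) → EuclideanSpace ℝ (Fin 3)}
    (hv : IsTypeIAncientMild C v) (hC : 0 ≤ C) {s M A A₁ t : ℝ} (hspos : 0 < s) (hM : 0 < M)
    (hA₁ : A₁ = 4 + M * Real.sqrt s) (hA₁A : A₁ < A)
    (hdata : ∀ y : EuclideanSpace ℝ (Fin 3), ‖y‖ ≤ A → ‖v (-s) y‖ ≤ 1 / 8)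
    (c_heat : 1 / 8 + C / Real.sqrt (-(-s)) * (2 * (2 : ℝ) ^ ((3 : ℝ) / 2) * (-(-s)) ^ (1 / 2 : ℝ)) /
      (A - (4 + M * Real.sqrt (-(-s)))) ≤ 1 / 4)
    (ht : t ∈ Ioo (-s) 0) {x : EuclideanSpace ℝ (Fin 3)} (hx : ‖x‖ < 4 + M * Real.sqrt (-t)) :
    ‖heatExtension (v (-s)) (t - -s) x‖ ≤ 1 / 4 := by
  rw [neg_neg] at c_heat
  have hxA₁ : ‖x‖ ≤ A₁ := by
    rw [hA₁]
    have h1 : Real.sqrt (-t) ≤ Real.sqrt s := Real.sqrt_le_sqrt (by linarith [ht.1])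
    have h2 := mul_le_mul_of_nonneg_left h1 hM.le
    linarith
  have hts : -s < 0 := neg_neg_of_pos hspos
  have hσ : 0 < t - -s := sub_pos.2 ht.1
  have hMf : 0 ≤ C / Real.sqrt s := div_nonneg hC (Real.sqrt_nonneg _)
  have hfb : ∀ y : EuclideanSpace ℝ (Fin 3), ‖v (-s) y‖ ≤ C / Real.sqrt s := fun y => by
    have := hv.norm_le hts y
    rwa [neg_neg] at this
  have h := norm_heatExtension_le_of_small_on_ball (f := v (-s)) (Mf := C / Real.sqrt s)
    (ε := 1 / 8) (A := A) (A₁ := A₁) (σ := t - -s) hMf (by norm_num) hA₁A hσ hfb hdata hxA₁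
  refine h.trans (le_trans ?_ c_heat)
  rw [← hA₁]
  have hσle : (t - -s) ^ (1 / 2 : ℝ) ≤ s ^ (1 / 2 : ℝ) :=
    Real.rpow_le_rpow hσ.le (by linarith [ht.2]) (by norm_num)
  have hAA : 0 < A - A₁ := sub_pos.2 hA₁A
  gcongr

/-! ### The ε-regularity statement -/

set_option maxHeartbeats 400000 in
/-- **Sup-norm ε-regularity for Type-I ancient mild fields with `L⁶` slices** (module
docstring): `t₁ < 0`, `A > 0`, `ε₀ > 0` depend only on `C`, `k₆`; smallness `‖v(t₁,·)‖ ≤ ε₀` on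
`B(0, A)` forces `‖v‖ ≤ 1` on `(t₁, 0) × B(0, 2)`.
[cite: KochNadirashviliSereginSverak2009, §4 p. 8 (arXiv:0709.3599)] -/
theorem epsilon_regularity {C k₆ : ℝ} (hC : 0 ≤ C) (hk₆ : 0 ≤ k₆) :
    ∃ t₁ < (0 : ℝ), ∃ A > (0 : ℝ), ∃ ε₀ > (0 : ℝ),
      ∀ v : ℝ → EuclideanSpace ℝ (Fin 3) → EuclideanSpace ℝ (Fin 3), IsTypeIAncientMild C v →
        (∀ τ : ℝ, τ < 0 → eLpNorm (v τ) 6 volume ≤ ENNReal.ofReal (k₆ * (-τ) ^ (-(1 / 4 : ℝ)))) →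
        (∀ y : EuclideanSpace ℝ (Fin 3), ‖y‖ ≤ A → ‖v t₁ y‖ ≤ ε₀) →
        ∀ t ∈ Ioo t₁ 0, ∀ x : EuclideanSpace ℝ (Fin 3), ‖x‖ < 2 → ‖v t x‖ ≤ 1 := by
  obtain ⟨C₀, hC₀, hK⟩ := exists_norm_oseenKernel_three_le
  -- ## the constants
  obtain ⟨I₂, hI₂⟩ : ∃ I₂ : ℝ, I₂ = ∫ w : EuclideanSpace ℝ (Fin 3), (1 + ‖w‖ ^ 2) ^ (-(2 : ℝ)) :=
    ⟨_, rfl⟩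
  have hI₂pos : 0 < I₂ := by
    rw [hI₂]
    exact integral_one_add_norm_sq_rpow_neg_pos (E := EuclideanSpace ℝ (Fin 3))
      (by rw [finrank_euclideanSpace_fin]; norm_num)
  obtain ⟨κ₁, hκ₁⟩ : ∃ κ₁ : ℝ, κ₁ = C₀ * I₂ := ⟨_, rfl⟩
  have hκ₁pos : 0 < κ₁ := by rw [hκ₁]; exact mul_pos hC₀ hI₂pos
  have hκ₁ne : κ₁ ≠ 0 := hκ₁pos.ne'
  obtain ⟨V, hV⟩ : ∃ V : ℝ, V = (volume : Measure (EuclideanSpace ℝ (Fin 3))).real (ball 0 1) :=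
    ⟨_, rfl⟩
  have hV0 : 0 ≤ V := by rw [hV]; exact measureReal_nonneg
  obtain ⟨κ₂, hκ₂⟩ : ∃ κ₂ : ℝ, κ₂ = C₀ * (3 * V) := ⟨_, rfl⟩
  have hκ₂0 : 0 ≤ κ₂ := by rw [hκ₂]; positivity
  obtain ⟨c₃, hc₃⟩ : ∃ c₃ : ℝ, c₃ = (3 * V * (5 / 9)) ^ (5 / 6 : ℝ) := ⟨_, rfl⟩
  have hc₃0 : 0 ≤ c₃ := by rw [hc₃]; positivity
  obtain ⟨c₄, hc₄⟩ : ∃ c₄ : ℝ, c₄ = (3 * V * (1 / 3)) ^ (2 / 3 : ℝ) := ⟨_, rfl⟩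
  have hc₄0 : 0 ≤ c₄ := by rw [hc₄]; positivity
  -- ## the parameters
  set η : ℝ := 1 / (128 * κ₁) with hη
  have hηpos : 0 < η := by rw [hη]; positivity
  have hηne : η ≠ 0 := hηpos.ne'
  have hη1 : 128 * κ₁ * η = 1 := by rw [hη]; field_simp
  set θ : ℝ := (η / (16 * κ₁ * C ^ 2 + 1)) ^ 2 with hθ
  have hden : 0 < 16 * κ₁ * C ^ 2 + 1 := by positivity
  have hθpos : 0 < θ := by rw [hθ]; positivity
  have hsqrtθ : Real.sqrt θ = η / (16 * κ₁ * C ^ 2 + 1) := by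
    rw [hθ, Real.sqrt_sq (by positivity)]
  set M : ℝ := 64 * κ₂ * C ^ 2 * θ ^ (-(1 / 4 : ℝ)) / η + 1 with hM
  have hθq : 0 ≤ θ ^ (-(1 / 4 : ℝ)) := Real.rpow_nonneg hθpos.le _
  have hMpos : 0 < M := by rw [hM]; positivity
  set Q : ℝ := 32 * κ₁ + 256 * η * C₀ * c₃ * k₆ + 8 * C₀ * c₄ * k₆ ^ 2 with hQ
  have hQ0 : 0 ≤ Q := by rw [hQ]; positivity
  set q : ℝ := 1 / (Q + 1) with hq
  have hqpos : 0 < q := by rw [hq]; positivity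
  have hq1 : q ≤ 1 := by rw [hq, div_le_one (by positivity)]; linarith
  have hXq : ∀ X : ℝ, 0 ≤ X → X ≤ Q → X * q ≤ 1 := by
    intro X hX0 hXQ
    rw [hq, mul_one_div, div_le_one (by positivity)]; linarith
  have hQa : 0 ≤ 32 * κ₁ := by positivity
  have hQb : 0 ≤ 256 * η * C₀ * c₃ * k₆ := by positivity
  have hQc : 0 ≤ 8 * C₀ * c₄ * k₆ ^ 2 := by positivity
  have hQ1 : 32 * κ₁ ≤ Q := by rw [hQ]; linarith
  have hQ2 : 256 * η * C₀ * c₃ * k₆ ≤ Q := by rw [hQ]; linarith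
  have hQ3 : 8 * C₀ * c₄ * k₆ ^ 2 ≤ Q := by rw [hQ]; linarith
  set s : ℝ := q ^ 4 with hs
  have hspos : 0 < s := by rw [hs]; positivity
  have hsqrt : Real.sqrt s = q ^ 2 := by
    rw [hs, show q ^ 4 = (q ^ 2) ^ 2 by ring, Real.sqrt_sq (by positivity)]
  have hs4 : s ^ (1 / 4 : ℝ) = q := by
    rw [hs, show (1 / 4 : ℝ) = ((4 : ℕ) : ℝ)⁻¹ by norm_num, Real.pow_rpow_inv_natCast hqpos.le (by norm_num)]
  have hq2 : q ^ 2 ≤ q := by nlinarith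
  set P : ℝ := 2 * (2 : ℝ) ^ ((3 : ℝ) / 2) with hP
  have hPpos : 0 < P := by rw [hP]; positivity
  set A₁ : ℝ := 4 + M * Real.sqrt s with hA₁
  set A : ℝ := A₁ + (8 * C * P + 1) with hA
  have hA₁pos : 0 < A₁ := by rw [hA₁]; positivity
  have hApos : 0 < A := by rw [hA]; positivity
  have h8CP : 0 < 8 * C * P + 1 := by positivity
  have hA₁A : A₁ < A := by rw [hA]; linarith
  clear_value η θ M Q q s P A₁ A
  refine ⟨-s, by linarith, A, hApos, 1 / 8, by norm_num, fun v hv hL6 hdata => ?_⟩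
  -- ## the numerical constraints
  have c_near : 16 * (C₀ * ∫ w : EuclideanSpace ℝ (Fin 3), (1 + ‖w‖ ^ 2) ^ (-(2 : ℝ))) * 1 *
      Real.sqrt (-(-s)) ≤ 1 := by
    rw [← hI₂, ← hκ₁, neg_neg, hsqrt, mul_one]
    have h1 := hXq (32 * κ₁) hQa hQ1
    have h2 : 16 * κ₁ * q ^ 2 ≤ 16 * κ₁ * q := mul_le_mul_of_nonneg_left hq2 (by positivity)
    have h3 : 0 ≤ κ₁ * q := by positivity
    linarith
  have c_a : 32 * (C₀ * ∫ w : EuclideanSpace ℝ (Fin 3), (1 + ‖w‖ ^ 2) ^ (-(2 : ℝ))) * 1 *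
      Real.sqrt (-(-s)) ≤ 1 := by
    rw [← hI₂, ← hκ₁, neg_neg, hsqrt, mul_one]
    have h1 := hXq (32 * κ₁) hQa hQ1
    have h2 : 32 * κ₁ * q ^ 2 ≤ 32 * κ₁ * q := mul_le_mul_of_nonneg_left hq2 (by positivity)
    linarith
  have c_eta : 32 * (C₀ * ∫ w : EuclideanSpace ℝ (Fin 3), (1 + ‖w‖ ^ 2) ^ (-(2 : ℝ))) * η ≤ 1 := by
    rw [← hI₂, ← hκ₁]; linarith [hη1]
  have c_η : 128 * (C₀ * ∫ w : EuclideanSpace ℝ (Fin 3), (1 + ‖w‖ ^ 2) ^ (-(2 : ℝ))) * η ≤ 1 := by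
    rw [← hI₂, ← hκ₁, hη1]
  have c_rec : 2 * (C₀ * ∫ w : EuclideanSpace ℝ (Fin 3), (1 + ‖w‖ ^ 2) ^ (-(2 : ℝ))) * C ^ 2 *
      Real.sqrt θ ≤ η / 8 := by
    rw [← hI₂, ← hκ₁, hsqrtθ]
    rw [show 2 * κ₁ * C ^ 2 * (η / (16 * κ₁ * C ^ 2 + 1)) = η / 8 * ((16 * κ₁ * C ^ 2) /
      (16 * κ₁ * C ^ 2 + 1)) by field_simp; ring]
    refine mul_le_of_le_one_right (by positivity) ?_
    rw [div_le_one hden]; linarith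
  have c_old : 8 * (C₀ * (3 * (volume : Measure (EuclideanSpace ℝ (Fin 3))).real (ball 0 1))) *
      C ^ 2 * θ ^ (-(1 / 4 : ℝ)) / M ≤ η / 8 := by
    rw [← hV, ← hκ₂, div_le_iff₀ hMpos, hM]
    have : η / 8 * (64 * κ₂ * C ^ 2 * θ ^ (-(1 / 4 : ℝ)) / η + 1) =
        8 * κ₂ * C ^ 2 * θ ^ (-(1 / 4 : ℝ)) + η / 8 := by
      field_simp
      ring
    rw [this]; linarith
  have c_heat : 1 / 8 + C / Real.sqrt (-(-s)) * (2 * (2 : ℝ) ^ ((3 : ℝ) / 2) * (-(-s)) ^ (1 / 2 : ℝ)) /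
      (A - (4 + M * Real.sqrt (-(-s)))) ≤ 1 / 4 := by
    rw [neg_neg, ← hP, ← hA₁]
    have hAA : A - A₁ = 8 * C * P + 1 := by rw [hA]; ring
    rw [hAA, Real.sqrt_eq_rpow]
    have hsp : 0 < s ^ (1 / 2 : ℝ) := Real.rpow_pos_of_pos hspos _
    have e : C / s ^ (1 / 2 : ℝ) * (P * s ^ (1 / 2 : ℝ)) = C * P := by
      field_simp
    rw [e]
    have h8 : 0 < 8 * C * P + 1 := by positivity
    have : C * P / (8 * C * P + 1) ≤ 1 / 8 := by
      rw [div_le_div_iff₀ h8 (by norm_num)]; linarith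
    linarith
  have c_ring : 256 * η * (C₀ * (3 * (volume : Measure (EuclideanSpace ℝ (Fin 3))).real (ball 0 1) *
      (5 / 9)) ^ (5 / 6 : ℝ)) * k₆ * (-(-s)) ^ (1 / 4 : ℝ) ≤ 1 := by
    rw [← hV, ← hc₃, neg_neg, hs4]
    have := hXq (256 * η * C₀ * c₃ * k₆) hQb hQ2
    linarith
  have c_ext : 32 * (C₀ * (3 * (volume : Measure (EuclideanSpace ℝ (Fin 3))).real (ball 0 1) *
      (1 / 3)) ^ (2 / 3 : ℝ)) * (4 : ℝ) ^ (-(2 : ℝ)) * k₆ ^ 2 * Real.sqrt (-(-s)) ≤ 1 / 4 := by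
    rw [← hV, ← hc₄, neg_neg, hsqrt]
    have h4 : (4 : ℝ) ^ (-(2 : ℝ)) = 1 / 16 := by
      rw [Real.rpow_neg (by norm_num), show (2 : ℝ) = ((2 : ℕ) : ℝ) by norm_num, Real.rpow_natCast]
      norm_num
    rw [h4]
    have h1 := hXq (8 * C₀ * c₄ * k₆ ^ 2) hQc hQ3
    have h0 : 0 ≤ C₀ * c₄ * k₆ ^ 2 := by positivity
    have h2 := mul_le_mul_of_nonneg_left hq2 h0
    linarith
  -- ## Stage 1
  have hdata' : ∀ y : EuclideanSpace ℝ (Fin 3), ‖y‖ ≤ A → ‖v (-s) y‖ ≤ 1 / 8 := hdata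
  have hA' : 4 + M * Real.sqrt (-(-s)) < A := by rw [neg_neg, ← hA₁]; exact hA₁A
  have hS1 : ∀ τ ∈ Ioo (-s) 0, ∀ y : EuclideanSpace ℝ (Fin 3),
      ‖y‖ < 4 + M * Real.sqrt (-τ) → ‖v τ y‖ ≤ 1 + η * (-τ) ^ (-(1 / 2 : ℝ)) :=
    stage1_typeI_small hC₀ hK hv (t₁ := -s) (R := 4) (A := A) (M := M) (a := 1) (η := η) (θ := θ)
      (ε₀ := 1 / 8) (neg_neg_of_pos hspos) hMpos one_pos hηpos hθpos (by norm_num) hA' hdata'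
      c_heat c_near c_eta c_rec c_old
  -- ## the heat term
  have hheat : ∀ t ∈ Ioo (-s) 0, ∀ x : EuclideanSpace ℝ (Fin 3),
      ‖x‖ < 4 + M * Real.sqrt (-t) → ‖heatExtension (v (-s)) (t - -s) x‖ ≤ 1 / 4 :=
    fun t ht x hx => heat_le_quarter hv hC hspos hMpos hA₁ hA₁A hdata' c_heat ht hx
  -- ## Stage 2
  exact stage2_bounded hC₀ hK hv hk₆ hL6 (t₁ := -s) (neg_neg_of_pos hspos) hMpos one_pos hηpos.le
    hS1 hheat c_a c_η c_ring c_ext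

end Summit.NavierStokesRegularity.NavierStokesRegularity.Theorems.RecurrentReductionD

end
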